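import Literature.Probability.RandomPlanarGeometry.PortGadgetLattice
import Literature.Probability.RandomPlanarGeometry.YangBaxterSAWGrouping

/-!
# The plus dictionary, I: self-avoiding plus paths are the Yang–Baxter walks visiting no face twice

Helper file of the line `registered` (`Lines/birth.lean`, reshaped) for the crux `SurfaceUniversality`
(stmt-CriticalPhenomena-6964, route `SAWCompassLattice`), stub `stub_lipPlusIsUnif : LipPlusIsUnif`
(the critical plus-lattice law IS the uniform point `(x_c, x_c, x_c, 0, 0)` of Glazman–Manolescu's
face-weight family, up to an `O(δ)` redraw).

The plus lattice (`plusLattice`: one centre `inr (f, ())` per face `f` of the square tiling, wired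
to the four ports `inl (f.side s)`) is bipartite ports/centres, so a walk from a port alternates
port, centre, port, … (`plusWalk_ind`; `support_eq_plusWeave`: the support is the interleaving
`plusWeave` of the ports `plusPorts` and the centres `plusCentres`). The COMBINATORIAL half of the
dictionary: along a self-avoiding plus path the centre between two consecutive ports `e ≠ e'` is
THE common face of `e, e'` (`map_some_plusCentres_eq`), so the port sequence of a self-avoiding
plus path through centres of faces of `Δ` is a Yang–Baxter walk of `Δ` whose arcs lie in pairwise
distinct faces (`plusToYB`, `nodup_map_arcFace_plusToYB`); `plusToYB` is injective
(`plusToYB_injective`) and onto those walks (`plusWalkOf`, `exists_plusToYB_eq`); a plus path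
through `n + 1` ports has `2n` edges (`length_eq_two_mul`).

Glazman–Manolescu, arXiv:1708.00395, §1 and Fig. 1 (the square-tiling walk); the plus gadget is
the route's (`PortGadgetLattice.lean`). Tagged [folklore] (bookkeeping).
-/

noncomputable section

namespace Summit.CriticalPhenomena.SAWScalingLimit.Theorems.SurfaceUniversality

open Literature.Probability.RandomPlanarGeometry
open Literature.Probability.RandomPlanarGeometry.SAW
open Literature.Probability.RandomPlanarGeometry.SAW.YangBaxter

/-! ### Vertices, ports and centres of plus walks -/

/-- The vertices of the plus lattice: ports `inl e` (mid-edges) and centres `inr (f, ())` (faces).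
[folklore] -/
abbrev PVert : Type := MidEdge ⊕ Face × Unit

/-- The ordered list of ports visited by a plus walk. [folklore] -/
def plusPorts {u w : PVert} (p : plusLattice.Walk u w) : List MidEdge :=
  p.support.filterMap Sum.getLeft?

/-- The ordered list of centres (as faces) visited by a plus walk. [folklore] -/
def plusCentres {u w : PVert} (p : plusLattice.Walk u w) : List Face :=
  p.support.filterMap fun v => (Sum.getRight? v).map Prod.fst

/-- The interleaving `inl e₀, inr f₁, inl e₁, inr f₂, …` of a list of ports and a list of centres
(junk tails when the lengths do not match). [folklore] -/
def plusWeave : List MidEdge → List Face → List PVert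
  | [], fs => fs.map fun f => Sum.inr (f, ())
  | e :: es, [] => Sum.inl e :: es.map Sum.inl
  | e :: es, f :: fs => Sum.inl e :: Sum.inr (f, ()) :: plusWeave es fs

/-- A port belongs to the interleaving iff it belongs to the list of ports. [folklore] -/
theorem inl_mem_plusWeave {e : MidEdge} : ∀ {es : List MidEdge} {fs : List Face},
    (Sum.inl e : PVert) ∈ plusWeave es fs ↔ e ∈ es
  | [], fs => by simp [plusWeave]
  | e' :: es, [] => by simp [plusWeave]
  | e' :: es, f :: fs => by simp [plusWeave, inl_mem_plusWeave]

/-- A centre belongs to the interleaving iff its face belongs to the list of centres. [folklore] -/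
theorem inr_mem_plusWeave {f : Face} {u : Unit} : ∀ {es : List MidEdge} {fs : List Face},
    (Sum.inr (f, u) : PVert) ∈ plusWeave es fs ↔ f ∈ fs
  | [], fs => by simp [plusWeave]
  | e' :: es, [] => by simp [plusWeave]
  | e' :: es, f' :: fs => by simp [plusWeave, inr_mem_plusWeave]

/-- The length of the interleaving. [folklore] -/
theorem length_plusWeave : ∀ (es : List MidEdge) (fs : List Face),
    (plusWeave es fs).length = es.length + fs.length
  | [], fs => by simp [plusWeave]
  | e :: es, [] => by simp [plusWeave]
  | e :: es, f :: fs => by simp [plusWeave, length_plusWeave es fs]; omega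

/-- Interleaving duplicate-free lists gives a duplicate-free list. [folklore] -/
theorem nodup_plusWeave : ∀ {es : List MidEdge} {fs : List Face}, es.Nodup → fs.Nodup →
    (plusWeave es fs).Nodup
  | [], fs, _, hfs => by
    simpa [plusWeave] using hfs.map fun f f' h => by simpa using h
  | e :: es, [], hes, _ => by
    simpa [plusWeave] using (List.nodup_cons.1 hes).imp_right fun h => h.map Sum.inl_injective
  | e :: es, f :: fs, hes, hfs => by
    rw [List.nodup_cons] at hes hfs
    simp only [plusWeave, List.nodup_cons, List.mem_cons, inl_mem_plusWeave, inr_mem_plusWeave,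
      reduceCtorEq, false_or]
    exact ⟨hes.1, hfs.1, nodup_plusWeave hes.2 hfs.2⟩

/-! ### Plus walks from a port alternate port, centre, port, … -/

/-- **Two-step induction on plus walks from a port**: such a walk is trivial, or one edge
port → centre, or two edges port → centre → port followed by a plus walk from a port (ports are
adjacent only to centres and centres only to ports). [folklore] -/
@[elab_as_elim]
theorem plusWalk_ind {motive : ∀ {a : MidEdge} {w : PVert}, plusLattice.Walk (Sum.inl a) w → Prop}
    (nil : ∀ a, motive (SimpleGraph.Walk.nil : plusLattice.Walk (Sum.inl a) (Sum.inl a)))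
    (one : ∀ (a : MidEdge) (f : Face) (h : plusLattice.Adj (Sum.inl a) (Sum.inr (f, ()))),
      motive (SimpleGraph.Walk.cons h SimpleGraph.Walk.nil))
    (two : ∀ (a : MidEdge) (f : Face) (e : MidEdge) (w : PVert)
      (h₁ : plusLattice.Adj (Sum.inl a) (Sum.inr (f, ())))
      (h₂ : plusLattice.Adj (Sum.inr (f, ())) (Sum.inl e)) (q : plusLattice.Walk (Sum.inl e) w),
      motive q → motive (SimpleGraph.Walk.cons h₁ (SimpleGraph.Walk.cons h₂ q))) :
    ∀ {a : MidEdge} {w : PVert} (p : plusLattice.Walk (Sum.inl a) w), motive p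
  | a, _, .nil => nil a
  | _, _, .cons (v := .inl _) h _ => absurd h (PortGadget.lattice_adj_inl_inl _ _ _)
  | a, _, .cons (v := .inr (f, ())) h .nil => one a f h
  | _, _, .cons (v := .inr (_, ())) _ (.cons (v := .inr (_, ())) h₂ _) =>
      absurd h₂ (plusLattice_adj_inr_inr _ _ _ _)
  | a, _, .cons (v := .inr (f, ())) h₁ (.cons (v := .inl e) h₂ q) =>
      two a f e _ h₁ h₂ q (plusWalk_ind nil one two q)

section PortsCentres

variable {u v w : PVert}

/-- Ports of a walk extended by an edge from a port. [folklore] -/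
@[simp] theorem plusPorts_cons_inl {e : MidEdge} (h : plusLattice.Adj (Sum.inl e) v)
    (q : plusLattice.Walk v w) : plusPorts (SimpleGraph.Walk.cons h q) = e :: plusPorts q := by
  simp [plusPorts]

/-- Ports of a walk extended by an edge from a centre. [folklore] -/
@[simp] theorem plusPorts_cons_inr {c : Face × Unit} (h : plusLattice.Adj (Sum.inr c) v)
    (q : plusLattice.Walk v w) : plusPorts (SimpleGraph.Walk.cons h q) = plusPorts q := by
  simp [plusPorts]

/-- Centres of a walk extended by an edge from a port. [folklore] -/
@[simp] theorem plusCentres_cons_inl {e : MidEdge} (h : plusLattice.Adj (Sum.inl e) v)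
    (q : plusLattice.Walk v w) : plusCentres (SimpleGraph.Walk.cons h q) = plusCentres q := by
  simp [plusCentres]

/-- Centres of a walk extended by an edge from a centre. [folklore] -/
@[simp] theorem plusCentres_cons_inr {f : Face} {t : Unit} (h : plusLattice.Adj (Sum.inr (f, t)) v)
    (q : plusLattice.Walk v w) : plusCentres (SimpleGraph.Walk.cons h q) = f :: plusCentres q := by
  simp [plusCentres]

/-- Ports of the trivial walk at a port. [folklore] -/
@[simp] theorem plusPorts_nil (a : MidEdge) :
    plusPorts (SimpleGraph.Walk.nil : plusLattice.Walk (Sum.inl a) (Sum.inl a)) = [a] := by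
  simp [plusPorts]

/-- Centres of the trivial walk at a port. [folklore] -/
@[simp] theorem plusCentres_nil (a : MidEdge) :
    plusCentres (SimpleGraph.Walk.nil : plusLattice.Walk (Sum.inl a) (Sum.inl a)) = [] := by
  simp [plusCentres]

/-- The ports of a walk from a port start with that port. [folklore] -/
theorem plusPorts_eq_cons {a : MidEdge} (p : plusLattice.Walk (Sum.inl a) w) :
    plusPorts p = a :: (plusPorts p).tail := by
  rw [plusPorts, ← p.cons_tail_support, List.filterMap_cons_some (by rfl)]
  rfl

/-- The ports of a walk from a port start with that port. [folklore] -/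
theorem plusPorts_head? {a : MidEdge} (p : plusLattice.Walk (Sum.inl a) w) :
    (plusPorts p).head? = some a := by
  rw [plusPorts_eq_cons p, List.head?_cons]

/-- The ports of the reversed walk. [folklore] -/
theorem plusPorts_reverse (p : plusLattice.Walk u w) : plusPorts p.reverse = (plusPorts p).reverse := by
  rw [plusPorts, SimpleGraph.Walk.support_reverse, List.filterMap_reverse, plusPorts]

/-- The ports of a walk to a port end with that port. [folklore] -/
theorem plusPorts_getLast? {b : MidEdge} (p : plusLattice.Walk u (Sum.inl b)) :
    (plusPorts p).getLast? = some b := by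
  rw [← List.reverse_reverse (plusPorts p), List.getLast?_reverse, ← plusPorts_reverse,
    plusPorts_head?]

/-- A self-avoiding walk has pairwise distinct ports. [folklore] -/
theorem nodup_plusPorts {p : plusLattice.Walk u w} (hp : p.IsPath) : (plusPorts p).Nodup := by
  refine hp.support_nodup.filterMap fun x x' e he he' => ?_
  rw [Option.mem_def, Sum.getLeft?_eq_some_iff] at he he'
  rw [he, he']

/-- A centre of a walk is a vertex of the walk. [folklore] -/
theorem inr_mem_support_of_mem_plusCentres {p : plusLattice.Walk u w} {f : Face}
    (hf : f ∈ plusCentres p) : (Sum.inr (f, ()) : PVert) ∈ p.support := by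
  obtain ⟨x, hx, hxf⟩ := List.mem_filterMap.1 hf
  obtain ⟨⟨f', t⟩, hx', rfl⟩ := Option.map_eq_some_iff.1 hxf
  rwa [Sum.getRight?_eq_some_iff.1 hx'] at hx

/-- A self-avoiding walk has pairwise distinct centres. [folklore] -/
theorem nodup_plusCentres {p : plusLattice.Walk u w} (hp : p.IsPath) : (plusCentres p).Nodup := by
  refine hp.support_nodup.filterMap fun x x' f hf hf' => ?_
  obtain ⟨⟨f₁, t₁⟩, h₁, rfl⟩ := Option.map_eq_some_iff.1 (Option.mem_def.1 hf)
  obtain ⟨⟨f₂, t₂⟩, h₂, h₁₂⟩ := Option.map_eq_some_iff.1 (Option.mem_def.1 hf')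
  rw [Sum.getRight?_eq_some_iff] at h₁ h₂
  rw [h₁, h₂, show f₂ = f₁ from h₁₂]

end PortsCentres

/-- **The support of a plus walk from a port is the interleaving of its ports and its centres.**
[folklore] -/
theorem support_eq_plusWeave {a : MidEdge} {w : PVert} (p : plusLattice.Walk (Sum.inl a) w) :
    p.support = plusWeave (plusPorts p) (plusCentres p) := by
  induction p using plusWalk_ind with
  | nil a => simp [plusWeave]
  | one a f h => simp [plusWeave, plusPorts, plusCentres]
  | two a f e w h₁ h₂ q ih =>
    rw [SimpleGraph.Walk.support_cons, SimpleGraph.Walk.support_cons, ih, plusPorts_cons_inl,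
      plusPorts_cons_inr, plusCentres_cons_inl, plusCentres_cons_inr, plusWeave]

/-- Two DISTINCT ports adjacent to one centre are two sides of its face: the face is their common
face. [folklore] -/
theorem arcFace_eq_of_adj {e e' : MidEdge} {f : Face} (h : plusLattice.Adj (Sum.inl e) (Sum.inr (f, ())))
    (h' : plusLattice.Adj (Sum.inr (f, ())) (Sum.inl e')) (hne : e ≠ e') : arcFace (e, e') = some f := by
  obtain ⟨s, rfl⟩ := (plusLattice_adj_inl_inr e f ()).1 h
  obtain ⟨t, rfl⟩ := (plusLattice_adj_inr_inl e' f ()).1 h'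
  exact arcFace_side_side f s t fun hst => hne (by rw [hst])

/-- Along a self-avoiding plus path from a port to a port, the centres are the common faces of the
consecutive ports (auxiliary form with a variable end vertex). [folklore] -/
theorem map_some_plusCentres_eq_aux {a : MidEdge} {w : PVert} (p : plusLattice.Walk (Sum.inl a) w) :
    ∀ b : MidEdge, w = Sum.inl b → p.IsPath →
      (plusCentres p).map some = (arcsOf (plusPorts p)).map arcFace := by
  induction p using plusWalk_ind with
  | nil a => intros; simp
  | one a f h => intro b hb; cases hb
  | two a f e w h₁ h₂ q ih =>
    intro b hb hpath
    rw [SimpleGraph.Walk.cons_isPath_iff, SimpleGraph.Walk.cons_isPath_iff,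
      SimpleGraph.Walk.support_cons, List.mem_cons, not_or] at hpath
    have hne : a ≠ e := fun hae => hpath.2.2 (hae ▸ q.start_mem_support)
    rw [plusCentres_cons_inl, plusCentres_cons_inr, plusPorts_cons_inl, plusPorts_cons_inr,
      List.map_cons, ih b hb hpath.1.1, plusPorts_eq_cons q, arcsOf_cons_cons, List.map_cons,
      arcFace_eq_of_adj h₁ h₂ hne]

/-- **Along a self-avoiding plus path between two ports, the centres are the common faces of the
consecutive ports.** [folklore] -/
theorem map_some_plusCentres_eq {a b : MidEdge} (p : plusLattice.Walk (Sum.inl a) (Sum.inl b))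
    (hp : p.IsPath) : (plusCentres p).map some = (arcsOf (plusPorts p)).map arcFace :=
  map_some_plusCentres_eq_aux p b rfl hp

/-- **A plus path between two ports through `n + 1` ports has `2n` edges.** [folklore] -/
theorem length_eq_two_mul {a b : MidEdge} (p : plusLattice.Walk (Sum.inl a) (Sum.inl b))
    (hp : p.IsPath) : p.length = 2 * (arcsOf (plusPorts p)).length := by
  have h1 : p.support.length = (plusPorts p).length + (plusCentres p).length := by
    rw [support_eq_plusWeave p, length_plusWeave]
  have h2 : (plusCentres p).length = (arcsOf (plusPorts p)).length := by
    simpa using congrArg List.length (map_some_plusCentres_eq p hp)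
  have h3 : (arcsOf (plusPorts p)).length + 1 = (plusPorts p).length := by
    rw [plusPorts_eq_cons p, arcsOf]
    simp
  rw [SimpleGraph.Walk.length_support] at h1
  omega

/-! ### The Yang–Baxter walk of a self-avoiding plus path -/

/-- **The self-avoiding plus paths from port `a` to port `b` through centres of faces of `Δ`**
(the index type of `PortGadget.pathMeasure plusLattice … (inFaces Δ) … (inl a) (inl b)`), with the
discrete σ-algebra. [folklore] -/
def PPath (Δ : Set Face) (a b : MidEdge) : Type :=
  {p : plusLattice.Walk (Sum.inl a) (Sum.inl b) // p.IsPath ∧ ∀ v ∈ p.support, v ∈ PortGadget.inFaces Δ}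

/-- Discrete σ-algebra on the plus paths. [folklore] -/
instance instMeasurableSpacePPath (Δ : Set Face) (a b : MidEdge) : MeasurableSpace (PPath Δ a b) := ⊤

/-- Every map out of the plus paths is measurable (discrete σ-algebra). [folklore] -/
theorem measurable_ppath {Δ : Set Face} {a b : MidEdge} {β : Type*} [MeasurableSpace β]
    (g : PPath Δ a b → β) : Measurable g := fun _ _ => MeasurableSpace.measurableSet_top

section ToYB

variable {Δ : Set Face} {a b : MidEdge}

/-- A centre of an admissible plus path is a face of `Δ`. [folklore] -/
theorem mem_of_mem_plusCentres (p : PPath Δ a b) {f : Face} (hf : f ∈ plusCentres p.1) : f ∈ Δ :=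
  (PortGadget.inr_mem_inFaces Δ f ()).1 (p.2.2 _ (inr_mem_support_of_mem_plusCentres hf))

/-- The faces of the arcs of the port sequence of a plus path are pairwise distinct (they are the
centres). [folklore] -/
theorem nodup_map_arcFace_plusPorts (p : PPath Δ a b) : ((arcsOf (plusPorts p.1)).map arcFace).Nodup := by
  rw [← map_some_plusCentres_eq p.1 p.2.1]
  exact (nodup_plusCentres p.2.1).map (Option.some_injective _)

/-- **The Yang–Baxter walk of a self-avoiding plus path**: its port sequence. Distinct ports (the
path is self-avoiding); consecutive ports are two distinct sides of the face of the centre between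
them, a face of `Δ`; consecutive arcs lie in the faces of consecutive centres, which are distinct;
and no face carries two arcs at all, its centre being visited once. [folklore] -/
def plusToYB (p : PPath Δ a b) : YBWalk Δ a b where
  mids := plusPorts p.1
  head_eq := plusPorts_head? p.1
  getLast_eq := plusPorts_getLast? p.1
  nodup := nodup_plusPorts p.2.1
  arc_mem q hq := by
    have h : arcFace q ∈ (plusCentres p.1).map some := by
      rw [map_some_plusCentres_eq p.1 p.2.1]
      exact List.mem_map.2 ⟨q, hq, rfl⟩
    obtain ⟨f, hf, hfq⟩ := List.mem_map.1 h
    exact ⟨f, mem_of_mem_plusCentres p hf, hfq.symm⟩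
  isChain := (List.pairwise_map.1 (nodup_map_arcFace_plusPorts p)).isChain
  noncross f hWE hSN := by
    have key : ∀ q ∈ arcsOf (plusPorts p.1), ∀ q' ∈ arcsOf (plusPorts p.1),
        arcFace q = some f → arcFace q' = some f → q = q' :=
      fun q hq q' hq' h h' => List.inj_on_of_nodup_map (nodup_map_arcFace_plusPorts p) hq hq' (h.trans h'.symm)
    rcases hWE with h | h <;> rcases hSN with h' | h' <;>
      have e := key _ h _ h' (arcFace_side_side f _ _ (by decide)) (arcFace_side_side f _ _ (by decide)) <;>
      simp only [Prod.mk.injEq, (Face.side_injective f).eq_iff, reduceCtorEq, and_self] at e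

/-- The mid-edges of `plusToYB p` are the ports of `p`. [folklore] -/
@[simp] theorem plusToYB_mids (p : PPath Δ a b) : (plusToYB p).mids = plusPorts p.1 := rfl

/-- **The arcs of `plusToYB p` lie in pairwise distinct faces.** [folklore] -/
theorem nodup_map_arcFace_plusToYB (p : PPath Δ a b) : ((plusToYB p).arcs.map arcFace).Nodup :=
  nodup_map_arcFace_plusPorts p

/-- A plus path has twice as many edges as its Yang–Baxter walk has arcs. [folklore] -/
theorem length_eq_two_mul_length_arcs (p : PPath Δ a b) : p.1.length = 2 * (plusToYB p).arcs.length :=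
  length_eq_two_mul p.1 p.2.1

/-- **`plusToYB` is injective**: a self-avoiding plus path is determined by its ports (the centres
are the common faces of consecutive ports, the support is the interleaving). [folklore] -/
theorem plusToYB_injective : Function.Injective (plusToYB (Δ := Δ) (a := a) (b := b)) := by
  intro p p' h
  have hports : plusPorts p.1 = plusPorts p'.1 := congrArg YBWalk.mids h
  have hcentres : plusCentres p.1 = plusCentres p'.1 := by
    apply (List.map_injective_iff.2 (Option.some_injective Face))
    rw [map_some_plusCentres_eq p.1 p.2.1, map_some_plusCentres_eq p'.1 p'.2.1, hports]
  refine Subtype.ext (SimpleGraph.Walk.support_injective ?_)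
  rw [support_eq_plusWeave, support_eq_plusWeave, hports, hcentres]

/-! ### Conversely: a Yang–Baxter walk visiting no face twice is the port sequence of a plus path -/

/-- **The plus walk port–centre–port–… through a chain of mid-edges** whose consecutive pairs share
faces of `Δ` (the centre between `e` and `e'` being THE common face of `e, e'`), together with its
ports (the given list) and its centres (the common faces). [folklore] -/
def plusWalkOf : ∀ (l : List MidEdge) (e b : MidEdge), l.head? = some e → l.getLast? = some b →
    (∀ q ∈ arcsOf l, ∃ f ∈ Δ, arcFace q = some f) →
    {w : plusLattice.Walk (Sum.inl e : PVert) (Sum.inl b) //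
      plusPorts w = l ∧ (plusCentres w).map some = (arcsOf l).map arcFace}
  | [], _, _, hh, _, _ => False.elim (by simp at hh)
  | [x], e, b, hh, hl, _ => by
    obtain rfl : x = e := by simpa using hh
    obtain rfl : x = b := by simpa using hl
    exact ⟨SimpleGraph.Walk.nil, plusPorts_nil x, by simp⟩
  | x :: y :: l, e, b, hh, hl, harc => by
    obtain rfl : x = e := by simpa using hh
    have hxy : ∃ f ∈ Δ, arcFace (x, y) = some f := harc _ (by rw [arcsOf_cons_cons]; exact List.mem_cons_self)
    have hsome : (arcFace (x, y)).isSome := by obtain ⟨f, -, hf⟩ := hxy; rw [hf, Option.isSome_some]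
    have hf : arcFace (x, y) = some ((arcFace (x, y)).get hsome) := (Option.some_get hsome).symm
    have hb := eq_faces_of_commonFace hf
    have h₁ : plusLattice.Adj (Sum.inl x) (Sum.inr ((arcFace (x, y)).get hsome, ())) :=
      (plusLattice_adj_inl_inr _ _ _).2 ((Face.exists_side_eq_iff _ _).2 hb.1)
    have h₂ : plusLattice.Adj (Sum.inr ((arcFace (x, y)).get hsome, ())) (Sum.inl y) :=
      (plusLattice_adj_inr_inl _ _ _).2 ((Face.exists_side_eq_iff _ _).2 hb.2)
    have r := plusWalkOf (y :: l) y b rfl (by simpa [List.getLast?_cons_cons] using hl)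
      (fun q hq => harc q (by rw [arcsOf_cons_cons]; exact List.mem_cons_of_mem _ hq))
    refine ⟨SimpleGraph.Walk.cons h₁ (SimpleGraph.Walk.cons h₂ r.1), ?_, ?_⟩
    · rw [plusPorts_cons_inl, plusPorts_cons_inr, r.2.1]
    · rw [plusCentres_cons_inl, plusCentres_cons_inr, List.map_cons, r.2.2, arcsOf_cons_cons,
        List.map_cons, ← hf]

/-- Every vertex of the interleaving is one of the ports or one of the centres. [folklore] -/
theorem mem_plusWeave_cases {es : List MidEdge} {fs : List Face} {v : PVert} (hv : v ∈ plusWeave es fs) :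
    (∃ e ∈ es, v = Sum.inl e) ∨ ∃ f ∈ fs, v = Sum.inr (f, ()) := by
  rcases v with e | ⟨f, ⟨⟩⟩
  · exact Or.inl ⟨e, inl_mem_plusWeave.1 hv, rfl⟩
  · exact Or.inr ⟨f, inr_mem_plusWeave.1 hv, rfl⟩

/-- **A Yang–Baxter walk whose arcs lie in pairwise distinct faces is the port sequence of a
self-avoiding plus path** (port–centre–port–… through the faces of its arcs: the ports are distinct
mid-edges, the centres distinct faces, all in `Δ`). [folklore] -/
theorem exists_plusToYB_eq (γ : YBWalk Δ a b) (hγ : (γ.arcs.map arcFace).Nodup) :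
    ∃ p : PPath Δ a b, plusToYB p = γ := by
  obtain ⟨w, hw₁, hw₂⟩ := plusWalkOf (Δ := Δ) γ.mids a b γ.head_eq γ.getLast_eq γ.arc_mem
  have hcentres : (plusCentres w).Nodup := by
    have h : ((plusCentres w).map some).Nodup := by rw [hw₂]; exact hγ
    exact h.of_map _
  have hpath : w.IsPath := SimpleGraph.Walk.IsPath.mk' (by
    rw [support_eq_plusWeave, hw₁]
    exact nodup_plusWeave γ.nodup hcentres)
  have hin : ∀ v ∈ w.support, v ∈ PortGadget.inFaces Δ := by
    intro v hv
    rw [support_eq_plusWeave] at hv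
    rcases mem_plusWeave_cases hv with ⟨e, -, rfl⟩ | ⟨f, hf, rfl⟩
    · exact PortGadget.inl_mem_inFaces Δ e
    · rw [PortGadget.inr_mem_inFaces]
      have h : some f ∈ (arcsOf γ.mids).map arcFace := by
        rw [← hw₂]
        exact List.mem_map.2 ⟨f, hf, rfl⟩
      obtain ⟨q, hq, hqf⟩ := List.mem_map.1 h
      obtain ⟨f', hf', hqf'⟩ := γ.arc_mem q hq
      rw [hqf', Option.some.injEq] at hqf
      exact hqf ▸ hf'
  exact ⟨⟨w, hpath, hin⟩, YBWalk.ext hw₁⟩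

end ToYB

/-- GLUE STUB of the line `registered` (crux stmt-CriticalPhenomena-6964), plus dictionary part I,
under its registered one-line signature: `plusToYB` is injective. [folklore] -/
theorem plusToYBInjective : ∀ (Δ : Set Face) (a b : MidEdge), Function.Injective (plusToYB (Δ := Δ) (a := a) (b := b)) :=
  fun _ _ _ => plusToYB_injective

end Summit.CriticalPhenomena.SAWScalingLimit.Theorems.SurfaceUniversality

end
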